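import Summits.QuantumFields.YangMills.Theorems.ColdStartUniversalityLatticeLangevinTimeAverageMaximal
import Summits.QuantumFields.YangMills.Theorems.ColdStartUniversalityLatticeLangevinLiebRobinsonMixingTime
import HarnessLib

/-!
# Route `ColdStartUniversality` (fixed-cut-off SZZ dynamics): ★★★ VOLUME-FREE UNIFORM-IN-TIME HOEFFDING BAND FOR LOCAL OBSERVABLES
# AT STRONG COUPLING `|β'| < 1/12`

Helper file (seat `ym-line-csu-p1`, g34; `--supports stmt-QuantumFields-24809`).  The uniform-in-time band of file 82
(`measureReal_exists_timeIntegral_ge_le_exp_of_corrector`, constant `288 β_u`) with the volume-free corrector bound `|u| ≤ 2C_f/ρ` of file 74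
(`|κ_t f̂| ≤ C_f e^(−ρt/2)`, g29/g30) gives, at `|β'| < 1/12`, for every torus size `L`, every strong solution of the SU(2) SZZ dynamics from a
deterministic start on ANY probability space, every `C⁵` local observable `f` with link-Lipschitz profile `ℓ ≥ 0` supported in `Λ` and
`|f∘coords| ≤ 1`, and ALL `T, ε > 0`:

  `P[ ∃ t ∈ [0,T], |∫_(0,t] (f∘coords(U_r) − μ_(β')(f∘coords)) dr| ≥ Tε ] ≤ 2 · exp(−ρ·T·ε² / (576·C_f))`
  (`measureReal_exists_timeIntegral_ge_le_exp_uniform_of_linkLipschitz`),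

`ρ = 1 − 12|β'|`, `C_f = 12π·#Λ·√(Σℓ²)·(6(7+6λ/ρ)³+2)` — the same constant as the final-time bound of file 74, independent of the volume.
THEOREMS ONLY, no definition, no sorry; [folklore].  HONEST FRAMING: fixed cut-off, fixed `|β'| < 1/12`; `UniformColdStartMixing` (24809) is NOT
restated; no crux, rung or summit statement is proved; the Yang–Mills mass gap is NOT proved.
-/

set_option autoImplicit false

noncomputable section

namespace Summit.QuantumFields.YangMills.Theorems.ColdStartUniversality.LiebRobinson

open MeasureTheory ProbabilityTheory Filter Topology Set
open scoped NNReal ENNReal BigOperators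
open Literature Literature.Probability.Process Literature.MathematicalPhysics.QuantumFieldTheory
open Literature.MathematicalPhysics.QuantumFieldTheory.Balaban1983to89
open Literature.MathematicalPhysics.QuantumLattice (fundamentalRep fundamentalLatticeRep continuous_fundamentalRep fundamentalRep_apply)

variable {L : ℕ} [NeZero L]

/-- ★★★ **VOLUME-FREE UNIFORM-IN-TIME HOEFFDING BAND for local observables at strong coupling.**  At `|β'| < 1/12`, for every torus size
`L`, every strong solution `U` from a deterministic start on ANY probability space, every `C⁵` local observable `f` with link-Lipschitz profile
`ℓ ≥ 0` supported in `Λ` and `|f∘coords| ≤ 1`, and all `T, ε > 0`: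
`P[ ∃ t ∈ [0,T], |∫_(0,t] (f∘coords(U_r) − μ_(β')(f∘coords)) dr| ≥ T·ε ] ≤ 2 · exp(−ρ·T·ε² / (576·C_f))`, `ρ = 1 − 12|β'|`. [folklore] -/
theorem measureReal_exists_timeIntegral_ge_le_exp_uniform_of_linkLipschitz (L : ℕ) [NeZero L] (β' : ℝ) (hβ : |β'| < 1 / 12)
    (x : GaugeConfig 3 L (Matrix.specialUnitaryGroup (Fin 2) ℂ))
    {Ω : Type} [MeasurableSpace Ω] {P : Measure Ω} [IsProbabilityMeasure P]
    {W : ℝ≥0 → Ω → (Edge 3 L × NoiseIdx 2 → ℝ)} (hW : IsFlatBrownian W P)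
    {U : ℝ≥0 → Ω → GaugeConfig 3 L (Matrix.specialUnitaryGroup (Fin 2) ℂ)} (hU0 : ∀ ω, U 0 ω = x)
    (hU : (latticeLangevinDynamics (fundamentalLatticeRep 2) β').IsSolution (fundamentalRep (Fin 2)) hW.natFiltration P W U)
    {f : (Edge 3 L × Fin 2 × Fin 2 × Bool → ℝ) → ℝ} (hf : ContDiff ℝ 5 f) (Λ : Finset (Edge 3 L)) {ℓ : Edge 3 L → ℝ} (hℓ : ∀ e, 0 ≤ ℓ e)
    (hℓΛ : ∀ e, e ∉ Λ → ℓ e = 0) {T : ℝ} (hT : 0 < T) {ε : ℝ} (hε : 0 < ε) :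
    let coords : GaugeConfig 3 L (Matrix.specialUnitaryGroup (Fin 2) ℂ) → (Edge 3 L × Fin 2 × Fin 2 × Bool → ℝ) :=
      fun V q => (fun z : ℂ => if q.2.2.2 then z.im else z.re)
        ((fundamentalRep (Fin 2) (V q.1) : Matrix (Fin 2) (Fin 2) ℂ) q.2.1 q.2.2.1)
    (∀ (e : Edge 3 L) (y y' : (GaugeConfig 3 L (Matrix.specialUnitaryGroup (Fin 2) ℂ))), (∀ g, g ≠ e → y g = y' g) →
      |f (coords y) - f (coords y')| ≤ ℓ e * frobNorm ((y e : Matrix (Fin 2) (Fin 2) ℂ) - (y' e : Matrix (Fin 2) (Fin 2) ℂ))) →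
    (∀ y, |f (coords y)| ≤ 1) →
    P.real {ω | ∃ t ∈ Icc (0 : ℝ) T, T * ε ≤ |∫ r in Ioc (0 : ℝ) t, (f (coords (U r.toNNReal ω)) -
        ∫ y, f (coords y) ∂(wilsonMeasure (d := 3) (L := L) (fundamentalRep (Fin 2)) β'))|} ≤
      2 * Real.exp (-((1 - 12 * |β'|) * T * ε ^ 2) /
        (576 * (12 * Real.pi * Λ.card * Real.sqrt (∑ e : Edge 3 L, ℓ e ^ 2) * (6 * (7 + 6 * ((1300 + 4 * Real.sqrt 2) * |β'|) / (1 - 12 * |β'|)) ^ 3 + 2)))) := by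
  intro coords hLip hf1
  classical
  haveI := secondCountableTopology_su2
  haveI := borelSpace_config L
  haveI : IsProbabilityMeasure (wilsonMeasure (d := 3) (L := L) (fundamentalRep (Fin 2)) β') :=
    isProbabilityMeasure_wilsonMeasure (d := 3) (L := L) (fundamentalRep (Fin 2)) (continuous_fundamentalRep (Fin 2)) β'
  obtain ⟨κ, hκM, -, hreal⟩ := exists_transitionKernel L β'
  haveI := hκM
  have hco : Continuous coords := continuous_coords (L := L)
  have hGc : Continuous fun y : (GaugeConfig 3 L (Matrix.specialUnitaryGroup (Fin 2) ℂ)) => f (coords y) := hf.continuous.comp hco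
  set ρ : ℝ := 1 - 12 * |β'| with hρdef
  have hρ : 0 < ρ := by rw [hρdef]; linarith
  set Cf : ℝ := 12 * Real.pi * Λ.card * Real.sqrt (∑ e : Edge 3 L, ℓ e ^ 2) *
    (6 * (7 + 6 * ((1300 + 4 * Real.sqrt 2) * |β'|) / (1 - 12 * |β'|)) ^ 3 + 2) with hCf
  have hCf0 : 0 ≤ Cf := by rw [hCf]; positivity
  set m : ℝ := ∫ y, f (coords y) ∂(wilsonMeasure (d := 3) (L := L) (fundamentalRep (Fin 2)) β') with hm
  -- the centred observable and its corrector from `exists_poisson_solution`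
  set Gh : GaugeConfig 3 L (Matrix.specialUnitaryGroup (Fin 2) ℂ) → ℝ := fun z => f (coords z) - m with hGh
  have hGhc : Continuous Gh := hGc.sub continuous_const
  have hm1 : |m| ≤ 1 := by
    have hh := norm_integral_le_of_norm_le_const (μ := wilsonMeasure (d := 3) (L := L) (fundamentalRep (Fin 2)) β')
      (f := fun y => f (coords y)) (C := 1) (Eventually.of_forall fun z => by simpa [Real.norm_eq_abs] using hf1 z)
    simpa [Real.norm_eq_abs] using hh
  have hGhb : ∀ z, |Gh z| ≤ 2 := fun z => (abs_sub _ _).trans (by linarith [hf1 z, hm1])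
  have hGh0 : ∫ z, Gh z ∂(wilsonMeasure (d := 3) (L := L) (fundamentalRep (Fin 2)) β') = 0 := by
    have hGi : Integrable (fun y => f (coords y)) (wilsonMeasure (d := 3) (L := L) (fundamentalRep (Fin 2)) β') :=
      (integrable_const (1 : ℝ)).mono' hGc.measurable.aestronglyMeasurable (Eventually.of_forall fun z => by simpa [Real.norm_eq_abs] using hf1 z)
    simp only [hGh]
    rw [integral_sub hGi (integrable_const m), integral_const, smul_eq_mul, probReal_univ, one_mul, hm, sub_self]
  obtain ⟨C, c, -, -, hP⟩ := exists_poisson_solution L β'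
  obtain ⟨u, hu_c, hu_eq, -, -, hPois⟩ := hP κ hreal Gh hGhc hGh0 2 hGhb
  -- volume-free bound on the corrector: `|u| ≤ 2 C_f / ρ`
  have hmix : ∀ (t : ℝ≥0) y, |∫ z, Gh z ∂(κ t y)| ≤ Cf * Real.exp (-(ρ / 2 * (t : ℝ))) := by
    intro t y
    have h1 := wilson_local_mixing_halfRate_of_linkLipschitz L β' hβ κ hreal hf Λ hℓ hℓΛ t hLip y
    have hGi : Integrable (fun z => f (coords z)) (κ t y) :=
      (integrable_const (1 : ℝ)).mono' hGc.measurable.aestronglyMeasurable (Eventually.of_forall fun z => by simpa [Real.norm_eq_abs] using hf1 z)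
    have heq : ∫ z, Gh z ∂(κ t y) = (∫ z, f (coords z) ∂(κ t y)) - m := by
      simp only [hGh]
      rw [integral_sub hGi (integrable_const m), integral_const, smul_eq_mul, probReal_univ, one_mul]
    rw [heq]
    exact h1
  -- degenerate profile `C_f = 0`: the right-hand side is `2`
  by_cases hCf : Cf = 0
  · refine measureReal_le_one.trans ?_
    rw [hCf, mul_zero, div_zero, Real.exp_zero]
    norm_num
  have hCfpos : 0 < Cf := lt_of_le_of_ne hCf0 (Ne.symm hCf)
  set βu : ℝ := 2 * Cf / ρ with hβu
  have hβu0 : 0 < βu := by positivity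
  have hu_b : ∀ y, |u y| ≤ βu := by
    intro y
    rw [hu_eq y]
    have hgi : IntegrableOn (fun t : ℝ => Cf * Real.exp (-(ρ / 2) * t)) (Ioi 0) :=
      (integrableOn_exp_mul_Ioi (by linarith : -(ρ / 2) < 0) 0).const_mul Cf
    have hle : ∀ t ∈ Ioi (0 : ℝ), ‖∫ z, Gh z ∂(κ t.toNNReal y)‖ ≤ Cf * Real.exp (-(ρ / 2) * t) := fun t ht => by
      rw [Real.norm_eq_abs]
      have h1 := hmix t.toNNReal y
      rwa [Real.coe_toNNReal _ (le_of_lt ht), show -(ρ / 2 * t) = -(ρ / 2) * t by ring] at h1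
    have h2 := norm_integral_le_of_norm_le hgi ((ae_restrict_iff' measurableSet_Ioi).2 (Eventually.of_forall hle))
    rw [Real.norm_eq_abs, integral_const_mul, integral_exp_mul_Ioi (by linarith : -(ρ / 2) < 0) 0] at h2
    calc |∫ t in Ioi (0 : ℝ), ∫ z, Gh z ∂(κ t.toNNReal y)| ≤ Cf * (-Real.exp (-(ρ / 2) * 0) / -(ρ / 2)) := h2
      _ = 2 * Cf / ρ := by rw [mul_zero, Real.exp_zero]; field_simp
      _ = βu := by rw [hβu]
  have hmain := measureReal_exists_timeIntegral_ge_le_exp_of_corrector β' κ hreal hGc hf1 hu_c.measurable hβu0 hu_b hPois x hW hU0 hU hT hε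
  refine hmain.trans (mul_le_mul_of_nonneg_left (Real.exp_le_exp.2 ?_) (by norm_num))
  -- `ρTε²/(576 C_f) ≤ Tε²/(288 β_u)` since `288 β_u = 576 C_f/ρ + 288 ≥ 576 C_f/ρ`
  rw [neg_div, neg_div, neg_le_neg_iff, hβu]
  apply le_of_eq
  field_simp
  ring

end Summit.QuantumFields.YangMills.Theorems.ColdStartUniversality.LiebRobinson

end
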